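import Literature.Claims.NS.Dicks2026

/-!
# Solo refutation kit — C146 `Dicks2026` (refuter of record ns-claims-refuter-6 g3)

Text of record: R. Dicks, «Millennium Problem 2 — Unconditional Forward Proof» (global regularity of the
3D incompressible Navier–Stokes equations conditional on Def 6.1), Zenodo 18963533 (2026), TEXT A
sha16 d00f084e01e7564c, 15 pp. (PDF page = printed page).

First failing step (print order of the printed proof of Thm 6.3, p.10 l.24–27 «Step 1»): PROPOSITION 3.1
«Topological Exhaustion», p.6 l.19–36 — for an enstrophy profile with `E(T*−) = ∞` the list «Case 1
(negative values after T*) / Case 2 (Ẽ = +∞ on [T*, T*+ε]) / Case 3 (Ẽ(T*+) < ∞, a finite right limit)»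
is asserted to be exhaustive (l.35–36).  Typed functions face `Literature.Claims.NS.Dicks2026.Prop31`
(l.182).  Countermodel: the extended-real profile `t ↦ |t − T*|⁻¹` is nonnegative (not Case 1), a finite
real at every instant (not Case 2), tends to `+∞` as `t ↑ T*` (the hypothesis `BlowsUpLeft`) AND as
`t ↓ T*`, so it has no finite right limit (not Case 3): the omitted fourth behaviour «finite after T* but
unbounded as t ↓ T*».  Kernel theorem `not_Prop31 : ¬ Prop31`, standard axioms.

WHAT THIS IS NOT: not a claim about NS regularity or blow-up; not a claim about any author beyond the
typed locator.
-/

open Filter Topology Set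

set_option linter.dupNamespace false

namespace Summit.NavierStokesRegularity.NavierStokesRegularity.Theorems.Dicks2026

open Literature.Claims.NS.Dicks2026

/-- The real profile `1/|t − T|` (finite at every instant; `|0|⁻¹ = 0` at `t = T`). [folklore] -/
noncomputable def rprof (T : ℝ) (t : ℝ) : ℝ := |t - T|⁻¹

/-- The same profile as an extended real, the type of Prop 3.1's `E`. [folklore] -/
noncomputable def prof (T : ℝ) (t : ℝ) : EReal := ((rprof T t : ℝ) : EReal)

/-- `1/|x| → +∞` as `x ↓ 0`. [folklore] -/
theorem tendsto_abs_inv_nhdsGT_zero : Tendsto (fun x : ℝ => |x|⁻¹) (𝓝[>] 0) atTop := by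
  refine (tendsto_inv_nhdsGT_zero).congr' ?_
  filter_upwards [self_mem_nhdsWithin] with x hx
  rw [abs_of_pos (mem_Ioi.mp hx)]

/-- `1/|t − T| → +∞` as `t ↓ T`. [folklore] -/
theorem tendsto_rprof_right (T : ℝ) : Tendsto (rprof T) (𝓝[>] T) atTop := by
  unfold rprof
  have h1 : Tendsto (fun t : ℝ => t - T) (𝓝[>] T) (𝓝[>] 0) := by
    refine tendsto_nhdsWithin_of_tendsto_nhds_of_eventually_within _ ?_ ?_
    · have : Tendsto (fun t : ℝ => t - T) (𝓝 T) (𝓝 (T - T)) :=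
        (continuous_id.sub continuous_const).tendsto T
      simpa using this.mono_left nhdsWithin_le_nhds
    · filter_upwards [self_mem_nhdsWithin] with t ht
      exact sub_pos.mpr (mem_Ioi.mp ht)
  exact tendsto_abs_inv_nhdsGT_zero.comp h1

/-- `1/|t − T| → +∞` as `t ↑ T`. [folklore] -/
theorem tendsto_rprof_left (T : ℝ) : Tendsto (rprof T) (𝓝[<] T) atTop := by
  unfold rprof
  have h1 : Tendsto (fun t : ℝ => T - t) (𝓝[<] T) (𝓝[>] 0) := by
    refine tendsto_nhdsWithin_of_tendsto_nhds_of_eventually_within _ ?_ ?_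
    · have : Tendsto (fun t : ℝ => T - t) (𝓝 T) (𝓝 (T - T)) :=
        (continuous_const.sub continuous_id).tendsto T
      simpa using this.mono_left nhdsWithin_le_nhds
    · filter_upwards [self_mem_nhdsWithin] with t ht
      exact sub_pos.mpr (mem_Iio.mp ht)
  have h3 : (fun t : ℝ => |t - T|⁻¹) = (fun x : ℝ => |x|⁻¹) ∘ (fun t => T - t) := by
    funext t; simp [abs_sub_comm]
  rw [h3]; exact tendsto_abs_inv_nhdsGT_zero.comp h1

/-- Real divergence to `+∞` transported to `EReal`. [folklore] -/
theorem tendsto_coe_of_tendsto_atTop {l : Filter ℝ} {f : ℝ → ℝ} (h : Tendsto f l atTop) :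
    Tendsto (fun t => ((f t : ℝ) : EReal)) l (𝓝 ⊤) := by
  rw [EReal.tendsto_nhds_top_iff_real]
  intro x
  filter_upwards [h.eventually (eventually_gt_atTop x)] with t ht
  exact EReal.coe_lt_coe_iff.mpr ht

/-- The profile satisfies Prop 3.1's hypothesis «E(T*−) = ∞». [folklore] -/
theorem blowsUpLeft_prof (T : ℝ) : BlowsUpLeft (prof T) T :=
  tendsto_coe_of_tendsto_atTop (tendsto_rprof_left T)

/-- … and also blows up from the right. [folklore] -/
theorem tendsto_prof_right (T : ℝ) : Tendsto (prof T) (𝓝[>] T) (𝓝 ⊤) :=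
  tendsto_coe_of_tendsto_atTop (tendsto_rprof_right T)

/-- Not Case 1: the profile is never negative. [folklore] -/
theorem not_case1_prof (T : ℝ) : ¬ Case1 (prof T) T := by
  rintro ⟨t, -, ht⟩
  have h0 : (0 : EReal) ≤ prof T t := by
    unfold prof rprof
    exact EReal.coe_nonneg.mpr (inv_nonneg.mpr (abs_nonneg _))
  exact not_lt.mpr h0 ht

/-- Not Case 2: the profile is a finite real at every instant (already at `t = T*`). [folklore] -/
theorem not_case2_prof (T : ℝ) : ¬ Case2 (prof T) T := by
  rintro ⟨ε, hε, h⟩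
  exact EReal.coe_ne_top _ (h T ⟨le_rfl, by linarith⟩)

/-- Not Case 3: no finite right limit, since the profile tends to `+∞` from the right. [folklore] -/
theorem not_case3_prof (T : ℝ) : ¬ Case3 (prof T) T := by
  rintro ⟨L, hL⟩
  exact EReal.coe_ne_top L (tendsto_nhds_unique hL (tendsto_prof_right T))

/-- **Refutes `Literature.Claims.NS.Dicks2026.Prop31` (Prop 3.1 «Topological Exhaustion», p.6 l.19–36;
Step 1 of the printed proof of Thm 6.3, p.10 l.24–27)**: the three cases are not exhaustive — the profile
`t ↦ |t − T*|⁻¹` blows up on the left of `T*`, is nonnegative and finite at every instant, and has no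
finite right limit at `T*`.  [cite: Dicks2026, Prop 3.1 p.6 l.19–36] -/
theorem not_Prop31 : ¬ Literature.Claims.NS.Dicks2026.Prop31 := by
  intro h
  rcases h (prof 0) 0 (blowsUpLeft_prof 0) with h1 | h2 | h3
  · exact not_case1_prof 0 h1
  · exact not_case2_prof 0 h2
  · exact not_case3_prof 0 h3

end Summit.NavierStokesRegularity.NavierStokesRegularity.Theorems.Dicks2026

-- WHAT THIS IS NOT: not a claim about NS regularity or blow-up; not a claim about any author beyond the typed locator.
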